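import Literature.MathematicalPhysics.QuantumFieldTheory.Balaban1983to89.B9SmoothHolderClassTReadings
import Literature.MathematicalPhysics.QuantumFieldTheory.Balaban1983to89.B9CoReadingCoordsHolderAdm
import Literature.MathematicalPhysics.QuantumFieldTheory.Balaban1983to89.B11SectGSmoothCutAdapters
import Literature.MathematicalPhysics.QuantumFieldTheory.Balaban1983to89.B9MultiscaleSmoothPartitionYNear
import Literature.MathematicalPhysics.QuantumFieldTheory.Balaban1983to89.B9GradViaDivLettersTransported

/-!
# `Balaban1983to89.B9SmoothHolderClassTClosure` — OPTION (2), the THIRD class axiom at the transported bond pin: the CLOSURE `hXcl` of the re-cut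
# letters («`bXH` is below the maximum of the 𝔠-sup class and the β₀-probe class», `B9Thm313WholeCutLettersSupFrom344.gXH_of_closure`) — a 𝔠-sup
# member plus a member into node00-def-Y's COVARIANT probe class `Φ^X_s` give a member INTO `bHZKT (U(Γ)) s p` ∕ the graded `bHZKG`, for every table

T. Bałaban, *Propagators for lattice gauge theories in a background field*, Commun. Math. Phys. **99** (1985) 389–434
[`Balaban1985BackgroundPropagators`, "B9"]; [4] = T. Bałaban, *Propagators and renormalization transformations for lattice gauge
theories. II*, Commun. Math. Phys. **96** (1984) 223–250 [`Balaban1984PropagatorsII`].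

statement-level skeleton of published theorems with citation tags; proofs where landed; nothing here is a claim about the
Yang–Mills mass gap

THE PRINTED LOCI.  [B9] (3.40) p. 397 (*"‖A‖_α = max_μ sup_{x,x′} |x − x′|^{−α}|R(U(Γ_{x,x′}))A_μ(x′) − A_μ(x)|"*), (3.41)–(3.42) p. 397, (3.43) p. 398
(*"‖ζ∇_UG′λ‖_β, ‖ζG′∇\*_Uλ‖_β ≦ B₀(β)(Lʲη)^{1−β}e^{−δ₀d(y,y′)}|λ| … ζ ∈ C₀^∞(Δ̃(y))"*), Thm 3.12 p. 423 + (3.138) p. 423 (the two words of G₁∇\*_U),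
Thm 3.13 p. 426; [4] (2.51)–(2.54) pp. 232–233 (block majorants, the triangle inequality of the multiscale distance), (2.137) p. 247 (the pair parameter).

WHY THIS FILE (cell `pub-ymgap`, node N06, seat dag-n06-l g22; sequel of `B9SmoothHolderClassT` p650626, `…Graded` p651925, `…TReadings` p654420).  The re-cut
letters of rows 20–21 (`B9Thm313WholeLettersCut`) display ONE free Hölder class `bXH` of G₁∇\*_U with three axioms: the cost `hκX` and the embedding `hX` into
𝔠⁽¹⁾ — both THEOREMS at the graded transported bond pin `bXH := bHZKG (taxiB U) p w` (p654420) — and the CLOSURE `hXcl` of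
`B9Thm313WholeCutLettersSupFrom344.gXH_of_closure`: *any operator bounded into the 𝔠⁽¹⁾-sup class AND into the β₀-probe class `𝔠_P^{(β₀−1)}` of the certificate's
Hölder probes `Φ^X_{β₀}` is bounded into `bXH`*.  At every FLAT class `hXcl` is unprovable (the probes read the COVARIANT quotient `R(U(Γ_{x,x′}))Ψ(x′) − Ψ(x)`,
dag-n06-l g20 note); at the TRANSPORTED class it holds BY CONSTRUCTION — `bHZKT`'s pair functional `trDif b g` IS the probes' pair reading along the same
table `g` (`probeK_inl_pair`).  THIS FILE proves it, for ANY source class `b₁` and ANY transporter table `g`: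
* §1 dictionary at print's units `c_f = Lᵏ` (`MemberY.hcfk`): `abs_cf_eq_nKT`, `len_eq_scl_div` (`Lʲη = L^{j(y)}∕Lᵏ`), `len_le_one`, `len_rpow_neg_eq_Wscl`
  (the 𝔠^{(−p)} weight IS the class's sup weight), ★ `wEtaK_eq_wK ∕ _eq_wKA` (the class's η-scale pair weight IS the probes' `(|x − x′|η)^{−s}`),
  `ΦX∕ΦY_holderProbesKA_parBY` (at def-Y's `parBY` the certificate's probe pin IS `probeK` along `taxiB`, rfl);
* §2 ★ `probeK_inl_pair` — the pair probe at `((x, x′), ν, c, c′)` reads `w(x, x′)·trDif b g (x, ν, c, c′) (x′, ·) F`; `wEtaK_mul_abs_trDif_eq` — on an admissible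
  pair the class's weighted pair term EQUALS the absolute pair probe of `holderProbesKA`'s family;
* §3 `hasMaj_ofBlocks_of_cNormR`, `abs_apply_le_of_hasMaj_cNormR` — a member into a real-weight sup class `𝔠^{(s)}` bounds every output value (dag-n06-w6's
  `abs_apply_le_of_hasMaj_ofBlocks` with the weight moved into the kernel);
* §4 ★★ `hasMaj_into_bHZKT_of_probeMaj` — `HasMaj b₁ 𝔠^{(−p)}_{blkBK} T (C·e^{−δd})` + `HasMaj b₁ 𝔠^{(s−1)}_{blkPK} (probeK b g (wKA s) (w₀K s) ∘ T) (C_b·e^{−δd})`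
  ⟹ `HasMaj b₁ (bHZKT g s p) T ((Lᵖ·C + C_b)·e^{δr}·e^{−δd})` (`0 ≤ s ≤ 1`, `s ≤ p`; the sup part on the ENLARGED block costs the level-window factor `Lᵖ`
  and the radius `r` of LAYER B — [4] (2.54); the pair part is read probe by probe, `(Lʲη)^{1−s} ≤ 1`);
* §5 ★★ `hasMaj_into_bHZKG_of_probeFamily` — an ∀ s ∈ (0,1) family of probe members with constants `C_b s`, `w s·C_b s ≤ C_b₀`, lands ONCE in the GRADED class
  (`hasMaj_into_bHZKG`): majorant `(Lᵖ·C + C_b₀)·e^{δr}·e^{−δd}` — PIN RECIPE (R6)'s landing adapter on the bond carrier;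
* §6 `…_near` — the radius discharged by dag-n06-w6's LAYER B (`dist_sIK_le_of_nearY`, `r := rNear d ℓ + 1`); ★ `hXcl_bHZKT` — `gXH_of_closure`'s binder SHAPE
  (source `𝔠_Y⁽⁰⁾`, sup component `cNorm … 1`, probe component `cNormR … (β₀ − 1)`) with the honest factor `L·e^{δr}` on the sup constant.
LOCATED (design, not typed): the SITE probe pin `holderProbesSA` reads SAME-BLOCK pairs only (`wSA`), while the site class `bHZT`'s pair domain is `NearPair` (cross-block,
forced by the J-letter) — no site twin of §4 is fed from SA-probe members; producers into `bH13` stay displayed ∀s-families (print-inhabitable by (3.43), all pairs).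
HONEST SCOPE.  Bookkeeping over landed definitions (my classes, dag-n06-d's probes, dag-n06-w6's enlargement lemmas); nothing of [B9]∕[4] asserted — the 𝔠-sup and
probe members are HYPOTHESES of printed species ((3.42)₃, (3.43)₂); no certificate edit; COUNT-NEUTRAL; N06 NOT discharged; nothing continuum, nothing about the
mass gap.  Cell `pub-ymgap` (HUMAN RULING D-0062), Track A node N06 [B9], seat `pub-ymgap-dag-n06-l` (g22), 2026-08-28.
-/

noncomputable section

namespace Literature.MathematicalPhysics.QuantumFieldTheory.Balaban1983to89.B9SmoothHolderClassTClosure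

open B6GlobalChartV1 (PV blkV1)
open B6Ineq2142KLevelV1 (β lvl)
open B6KLevelCensusIndexV1 (KIdx Adm kGeo len_eq)
open B6Prop22KLevelTorusCensusEta (nKT one_le_nKT)
open B9GeoNormsKLevelV1 (geo9K geo9K_len_kGeo)
open B9GeoLemma21KLevelV1 (geo9K_dist_triangle geo9K_len_pos)
open B9Thm34Ext (toB6)
open B11SectG (BlockNorm HasMaj)
open B11SectGGlobal (Size)
open B11SectGGlobalSizes
open B11SectGSmoothCutT (Size.ofPairsT ofPairsT_sz_le)
open B11SectGSmoothCutAdapters (abs_apply_le_of_hasMaj_ofBlocks)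
open B9Thm312Whole (cNorm wt)
open B9Thm312WholeClasses (cNormR cNormR_loc)
open B9Eq39Adjoint (R)
open B9CoReadingCoords (XBK blkBK assembleK)
open B9CoReadingCoordsS (sIK)
open B9CoReadingCoordsHolder (PK blkPK probeK probeK_inl wK w₀K wK_nonneg)
open B9CoReadingCoordsHolderAdm (wKA wKA_of_adm wKA_nonneg holderProbesKA)
open B9GradViaDivLettersTransported (taxiB)
open B9GradViaDivLettersAtPinsHolderPairs (sIK_chartY)
open B9MultiscaleSmoothPartitionY (scl scl_pos NearY levY_window_of_nearY)
open B9MultiscaleSmoothPartitionYNear (rNear dist_sIK_le_of_nearY)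
open B9SmoothHolderClassS (Wscl Wscl_nonneg scl_div_nKT_pos_le_one one_le_Wscl)
open B9SmoothHolderClassK (srcY NearPairK wEtaK wEtaK_nonneg src_ne_of_nearPairK)
open B9SmoothHolderClassT (trDif trDif_apply bHZKT bHZKT_loc bHZKT_isLoc_iff)
open B9SmoothHolderClassGraded (bHZKG hasMaj_into_bHZKG)
open B9GradViaDivLettersSmoothTerms (blkV1_level_eq_levY Wscl_le_of_lvl_le)
open Node00 (SiteY FBondY IBondY toKT levY CfgY parBY)

variable {d ℓ : ℕ} {hd : 1 ≤ d + 1} {hL : Odd (ℓ + 1) ∧ 1 < ℓ + 1} {b₀ b₁ : ℝ}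
variable {𝔸 : Type} [NormedRing 𝔸] [NormedAlgebra ℂ 𝔸]
variable {κ : Type} [Fintype κ]
variable (i : KIdx d ℓ hd hL b₀ b₁)

/-! ## §1 The dictionary at print's units `c_f = Lᵏ` -/

section Units

/-- at print's units (`MemberY.hcfk`): `|c_f| = Lᵏ = nKT`. [cite: Balaban1984PropagatorsII, (2.1) p.224 («η = L^{−k}»), dictionary] -/
theorem abs_cf_eq_nKT (hcfk : i.cf = (((ℓ + 1 : ℕ) : ℝ)) ^ i.k) : |i.cf| = (nKT (toKT i) : ℝ) := by
  rw [hcfk, abs_of_nonneg (by positivity)]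
  simp [nKT, toKT]

/-- `Lʲη = L^{j(y)} ∕ Lᵏ` at print's units. [cite: Balaban1985BackgroundPropagators, (3.41) p.397; Balaban1984PropagatorsII, (2.1) p.224] -/
theorem len_eq_scl_div (hcf : |i.cf| = (nKT (toKT i) : ℝ)) (y : IBondY i) : (geo9K i).len y = scl i y / (nKT (toKT i) : ℝ) := by
  rw [geo9K_len_kGeo, len_eq, scl, hcf]

/-- `Lʲη ≤ 1` (`j(y) ≤ k`). [cite: Balaban1984PropagatorsII, (2.1) p.224, bookkeeping] -/
theorem len_le_one (hcf : |i.cf| = (nKT (toKT i) : ℝ)) (y : IBondY i) : (geo9K i).len y ≤ 1 := by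
  rw [len_eq_scl_div i hcf]; exact (scl_div_nKT_pos_le_one i y).2

/-- the weight of `𝔠^{(−p)}` IS the class's sup weight: `(Lʲη)^{−p} = Wscl p`. [cite: Balaban1985BackgroundPropagators, (3.42) p.397 + (3.43) p.398, dictionary] -/
theorem len_rpow_neg_eq_Wscl (hcf : |i.cf| = (nKT (toKT i) : ℝ)) (p : ℝ) (y : IBondY i) : (geo9K i).len y ^ (-p) = Wscl i p y := by
  rw [len_eq_scl_div i hcf, Wscl, Real.rpow_neg (scl_div_nKT_pos_le_one i y).1.le]

omit [Fintype κ] in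
/-- ★ the class's η-scale pair weight IS the probes' pair weight `(|x − x′|·η)^{−s}` at print's units.
[cite: Balaban1985BackgroundPropagators, (3.40) p.397; Balaban1984PropagatorsII, (2.137) p.247, dictionary] -/
theorem wEtaK_eq_wK (hcf : |i.cf| = (nKT (toKT i) : ℝ)) (s : ℝ) (q q' : XBK κ i) : wEtaK i s q q' = wK i s q.1 q'.1 := by
  rw [wEtaK, wK, hcf, ← div_eq_mul_inv, Real.rpow_neg (by positivity)]

omit [Fintype κ] in
/-- … and, on an ADMISSIBLE pair, the weight of the certificate's probe pin `holderProbesKA`. [cite: Balaban1984PropagatorsII, (2.137) p.247, dictionary] -/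
theorem wEtaK_eq_wKA (hcf : |i.cf| = (nKT (toKT i) : ℝ)) (s : ℝ) {q q' : XBK κ i} (h : Adm i q.1 q'.1) : wEtaK i s q q' = wKA i s q.1 q'.1 := by
  rw [wKA_of_adm i s h, wEtaK_eq_wK i hcf]

end Units

/-! ## §2 The pair probe reads the class's transported pair difference -/

section Probe

variable (b : Module.Basis κ ℝ 𝔸)

/-- ★ **THE PAIR PROBE IS THE WEIGHTED TRANSPORTED PAIR DIFFERENCE**: at the probe `((x, x′), ν, c, c′)` the probe map reads `w(x, x′)·trDif b g (x, ν, c, c′) (x′, ·) F`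
(the partner's slots are not read by `trDif`). [cite: Balaban1985BackgroundPropagators, (3.40) p.397, dictionary] -/
theorem probeK_inl_pair {S D : Type} (g : S → S → 𝔸ˣ) (w : S → S → ℝ) (w₀ : S → ℝ) (F : S × D × κ × κ → ℝ) (q q' : S × D × κ × κ) :
    probeK b g w w₀ F (Sum.inl ((q.1, q'.1), q.2)) = w q.1 q'.1 * trDif b g q q' F := by
  rw [probeK_inl, trDif_apply]

omit [Fintype κ] in
/-- the anchor of a pair probe is the block of its base point. [cite: Balaban1985BackgroundPropagators, (3.43) p.398 («ζ ∈ C₀^∞(Δ̃(y))»), dictionary] -/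
theorem blkPK_inl {S D I : Type} (blk : S → I) (p : (S × S) × D × κ × κ) : blkPK (κ := κ) blk (Sum.inl p) = blk p.1.1 := rfl

/-- ★ on an admissible pair the class's weighted pair term EQUALS the absolute pair probe of the certificate's family `probeK b g (wKA s) (w₀K s)`.
[cite: Balaban1985BackgroundPropagators, (3.40) p.397; Balaban1984PropagatorsII, (2.137) p.247, dictionary] -/
theorem wEtaK_mul_abs_trDif_eq (hcf : |i.cf| = (nKT (toKT i) : ℝ)) (g : FBondY i → FBondY i → 𝔸ˣ) (s : ℝ) (F : XBK κ i → ℝ) {q q' : XBK κ i}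
    (hqq : NearPairK i q q') :
    wEtaK i s q q' * |trDif b g q q' F| = |probeK b g (wKA i s) (w₀K i s) F (Sum.inl ((q.1, q'.1), q.2))| := by
  rw [probeK_inl_pair, abs_mul, abs_of_nonneg (wKA_nonneg i s _ _), wEtaK_eq_wKA i hcf s hqq.2.1]

/-- ★ **AT node00-def-Y's BOND TRANSPORTER `parBY` THE CERTIFICATE'S PROBE FAMILY IS `probeK` ALONG `taxiB`**: the probe pin `holderProbesKA … (parBY i) bI` reads, at
`(U, s)`, exactly the family `probeK b (taxiB i B cfg U) (wKA s) (w₀K s)` of §4's hypothesis — so the class `bHZKT (taxiB U) s p` and the probes share their table.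
[cite: Balaban1985BackgroundPropagators, (3.40) p.397 («Γ_{x,x′} a shortest contour»), dictionary] -/
theorem ΦX_holderProbesKA_parBY [CompleteSpace 𝔸] [FiniteDimensional ℝ 𝔸] [DecidableEq κ] (B : B9.Backgrounds) (cfg : B.Cfg → CfgY 𝔸 i)
    (bI : FBondY i → IBondY i) (U : B.Cfg) (s : ℝ) :
    (holderProbesKA i b B cfg (parBY i) bI).ΦX U s = probeK b (taxiB i B cfg U) (wKA i s) (w₀K i s) := rfl

/-- … and the same for `ΦY`. [cite: Balaban1985BackgroundPropagators, (3.40) p.397, dictionary] -/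
theorem ΦY_holderProbesKA_parBY [CompleteSpace 𝔸] [FiniteDimensional ℝ 𝔸] [DecidableEq κ] (B : B9.Backgrounds) (cfg : B.Cfg → CfgY 𝔸 i)
    (bI : FBondY i → IBondY i) (U : B.Cfg) (s : ℝ) :
    (holderProbesKA i b B cfg (parBY i) bI).ΦY U s = probeK b (taxiB i B cfg U) (wKA i s) (w₀K i s) := rfl

end Probe

/-! ## §3 From a member into a real-weight sup class to value bounds -/

section Values

variable [Fintype (geo9K i).Site] {R : ℝ} {H : Prop} (hlen : ∀ y : (geo9K i).Site, 0 ≤ (geo9K i).len y)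
variable {X : Type} [Fintype X] {F₁ : Type} [AddCommGroup F₁] [Module ℝ F₁]

/-- a member into `𝔠^{(s)}` is a member into the sharp-block sup class with the weight `(Lʲη)^{−s}` moved into the kernel.
[cite: Balaban1985BackgroundPropagators, (3.42) p.397; Balaban1984PropagatorsII, (2.51) p.232, bookkeeping] -/
theorem hasMaj_ofBlocks_of_cNormR {blk : X → IBondY i} {b₁ : BlockNorm (toB6 (geo9K i) R H) F₁} {T : F₁ →ₗ[ℝ] (X → ℝ)}
    {K : IBondY i → IBondY i → ℝ} {s : ℝ} (h : HasMaj b₁ (cNormR R H blk hlen s) T K) :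
    HasMaj b₁ (BlockNorm.ofBlocks (toB6 (geo9K i) R H) blk) T (fun y y' => ((geo9K i).len y ^ s)⁻¹ * K y y') := by
  intro y' μ hμ y
  have h1 := h y' μ hμ y
  rw [cNormR_loc] at h1
  have hpos : 0 < (geo9K i).len y ^ s := Real.rpow_pos_of_pos (geo9K_len_pos i y) s
  calc (BlockNorm.ofBlocks (toB6 (geo9K i) R H) blk).loc y (T μ)
      = ((geo9K i).len y ^ s)⁻¹ * ((geo9K i).len y ^ s * (BlockNorm.ofBlocks (toB6 (geo9K i) R H) blk).loc y (T μ)) := by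
        rw [← mul_assoc, inv_mul_cancel₀ hpos.ne', one_mul]
    _ ≤ ((geo9K i).len y ^ s)⁻¹ * (K y y' * b₁.loc y' μ) := mul_le_mul_of_nonneg_left h1 (inv_nonneg.2 hpos.le)
    _ = _ := by ring

open Classical in
/-- under a member into `𝔠^{(s)}` every output VALUE obeys `|(T μ)(x)| ≤ (Lʲ⁽ˣ⁾η)^{−s}·K(blk x, y′)·loc_{y′} μ`.
[cite: Balaban1984PropagatorsII, (2.51) p.232, bookkeeping] -/
theorem abs_apply_le_of_hasMaj_cNormR {blk : X → IBondY i} {b₁ : BlockNorm (toB6 (geo9K i) R H) F₁} {T : F₁ →ₗ[ℝ] (X → ℝ)}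
    {K : IBondY i → IBondY i → ℝ} {s : ℝ} (h : HasMaj b₁ (cNormR R H blk hlen s) T K) {y' : IBondY i} {μ : F₁} (hμ : b₁.IsLoc y' μ) (x : X) :
    |T μ x| ≤ ((geo9K i).len (blk x) ^ s)⁻¹ * K (blk x) y' * b₁.loc y' μ :=
  abs_apply_le_of_hasMaj_ofBlocks (hasMaj_ofBlocks_of_cNormR i hlen h) hμ x

end Values

/-! ## §4 ★★ A 𝔠-sup member plus a probe member give a member INTO the transported bond class -/

section Main

variable [Fintype (geo9K i).Site] (b : Module.Basis κ ℝ 𝔸) (g : FBondY i → FBondY i → 𝔸ˣ) {R : ℝ} {H : Prop}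
variable (hlen : ∀ y : (geo9K i).Site, 0 ≤ (geo9K i).len y) {bI : FBondY i → IBondY i}
variable {F₁ : Type} [AddCommGroup F₁] [Module ℝ F₁]

/-- ★★ **THE CLOSURE OF THE TRANSPORTED BOND CLASS UNDER «𝔠-SUP ⊔ COVARIANT PROBE» MEMBERS.**  For ANY source class `b₁`, ANY transporter table `g`, exponents
`0 ≤ s ≤ 1`, `s ≤ p`: if `T` is bounded into the `(Lʲη)^{−p}`-weighted sharp sup class of the bond carrier with majorant `C·e^{−δd}` ((3.42)₃-type word) AND the
probed operator `Φ_s ∘ T` — `Φ_s = probeK b g (wKA s) (w₀K s)`, the certificate's `(holderProbesKA …).ΦX U s` — is bounded into the probe class `𝔠_P^{(s−1)}` with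
majorant `C_b·e^{−δd}` ((3.43)₂-type word), then `T` is bounded INTO `bHZKT g s p` with majorant `(Lᵖ·C + C_b)·e^{δr}·e^{−δd}`.  Sup part: a value at `q` seen from
`Δ̃(y)` lives in the block `y″ = bI q.1` at distance `≤ r` from `y` (LAYER B) one level away, so `Wscl p y ≤ Lᵖ·Wscl p y″ = Lᵖ·(Lʲ″η)^{−p}` and (2.54) moves the
kernel; pair part: the weighted transported term IS the pair probe anchored at `y″`, read with `(Lʲ″η)^{1−s} ≤ 1`.  Binders: the certificate's `hlev hbI0`, the LAYER-B
radius `hN`, print's units `hcf`. [cite: Balaban1985BackgroundPropagators, (3.40) p.397 + (3.42)–(3.43) pp.397–398 + Thm 3.12 p.423 ((3.138)); Balaban1984PropagatorsII, (2.51)–(2.54) pp.232–233, (2.137) p.247] -/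
theorem hasMaj_into_bHZKT_of_probeMaj {s p : ℝ} (hs0 : 0 ≤ s) (hs1 : s ≤ 1) (hsp : s ≤ p)
    (hlev : ∀ f : FBondY i, lvl i.hN i.D i.hk (bI f) = (blkV1 i.hN i.D f).1.1) (hbI0 : ∀ f : FBondY i, bI f = bI ⟨f.src, 0⟩)
    {r δ : ℝ} (hδ : 0 ≤ δ) (hN : ∀ (y : IBondY i) (z : SiteY i), NearY i y z → (geo9K i).dist y (sIK i bI z) ≤ r)
    (hcf : |i.cf| = (nKT (toKT i) : ℝ))
    {b₁ : BlockNorm (toB6 (geo9K i) R H) F₁} {T : F₁ →ₗ[ℝ] (XBK κ i → ℝ)} {C Cb : ℝ} (hC : 0 ≤ C) (hCb : 0 ≤ Cb)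
    (hsup : HasMaj b₁ (cNormR R H (blkBK i bI) hlen (-p)) T (fun a a' => C * Real.exp (-(δ * (geo9K i).dist a a'))))
    (hpr : HasMaj b₁ (cNormR R H (blkPK bI) hlen (s - 1)) (probeK b g (wKA i s) (w₀K i s) ∘ₗ T)
      (fun a a' => Cb * Real.exp (-(δ * (geo9K i).dist a a')))) :
    HasMaj b₁ (bHZKT (κ := κ) i b g (R := R) (H := H) hs0 hs1 hsp) T
      (fun y y' => ((((ℓ + 1 : ℕ) : ℝ)) ^ p * C + Cb) * Real.exp (δ * r) * Real.exp (-(δ * (geo9K i).dist y y'))) := by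
  classical
  intro y' μ hμ y
  rw [bHZKT_loc]
  set E : ℝ := Real.exp (δ * r) * Real.exp (-(δ * (geo9K i).dist y y')) with hE
  have hE0 : 0 ≤ E := by positivity
  have hl0 : 0 ≤ b₁.loc y' μ := b₁.loc_nonneg _ _
  have hp0 : 0 ≤ p := hs0.trans hsp
  have hL0 : (0 : ℝ) ≤ ((ℓ + 1 : ℕ) : ℝ) := Nat.cast_nonneg _
  have hLp : 0 ≤ (((ℓ + 1 : ℕ) : ℝ)) ^ p := Real.rpow_nonneg hL0 p
  -- geometry of a point seen from `Δ̃(y)`: its bond's block is within `r` of `y` and one level away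
  have hgeo : ∀ q : XBK κ i, NearY i y (srcY i q) →
      (geo9K i).dist y (bI q.1) ≤ r ∧ lvl i.hN i.D i.hk (bI q.1) ≤ lvl i.hN i.D i.hk y + 1 := by
    intro q hq
    have hsrc : sIK i bI (srcY i q) = bI q.1 := by rw [srcY, sIK_chartY, ← hbI0 q.1]
    refine ⟨by have h := hN y (srcY i q) hq; rwa [hsrc] at h, ?_⟩
    rw [hlev q.1, blkV1_level_eq_levY]
    exact (levY_window_of_nearY i hq).2
  -- (2.54): moving the kernel from the block of the value to `y`
  have hexp : ∀ q : XBK κ i, NearY i y (srcY i q) → Real.exp (-(δ * (geo9K i).dist (bI q.1) y')) ≤ E := by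
    intro q hq
    rw [hE, ← Real.exp_add]
    refine Real.exp_le_exp.2 ?_
    nlinarith [mul_le_mul_of_nonneg_left (geo9K_dist_triangle i y (bI q.1) y') hδ, mul_le_mul_of_nonneg_left (hgeo q hq).1 hδ]
  -- THE SUP PART, value by value
  have hWy : 0 < Wscl i p y := lt_of_lt_of_le zero_lt_one (one_le_Wscl i hp0 y)
  set M : ℝ := (Wscl i p y)⁻¹ * ((((ℓ + 1 : ℕ) : ℝ)) ^ p * C * E * b₁.loc y' μ) with hM
  have hM0 : 0 ≤ M := by positivity
  have hpt : ∀ q : XBK κ i, NearY i y (srcY i q) → |T μ q| ≤ M := by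
    intro q hq
    have hv := abs_apply_le_of_hasMaj_cNormR i hlen hsup hμ q
    have hblk : blkBK i bI q = bI q.1 := rfl
    rw [hblk, len_rpow_neg_eq_Wscl i hcf] at hv
    have hW'' : 0 < Wscl i p (bI q.1) := lt_of_lt_of_le zero_lt_one (one_le_Wscl i hp0 (bI q.1))
    have hWle : Wscl i p y ≤ (((ℓ + 1 : ℕ) : ℝ)) ^ p * Wscl i p (bI q.1) := by
      have h := Wscl_le_of_lvl_le i hp0 (k := 1) (hgeo q hq).2
      simp only [Nat.cast_one, one_mul] at h
      exact h
    have hinv : (Wscl i p (bI q.1))⁻¹ ≤ (((ℓ + 1 : ℕ) : ℝ)) ^ p / Wscl i p y := by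
      rw [le_div_iff₀ hWy, inv_mul_eq_div, div_le_iff₀ hW'']
      exact hWle
    have hCe : C * Real.exp (-(δ * (geo9K i).dist (bI q.1) y')) ≤ C * E := mul_le_mul_of_nonneg_left (hexp q hq) hC
    calc |T μ q| ≤ (Wscl i p (bI q.1))⁻¹ * (C * Real.exp (-(δ * (geo9K i).dist (bI q.1) y'))) * b₁.loc y' μ := hv
      _ ≤ ((((ℓ + 1 : ℕ) : ℝ)) ^ p / Wscl i p y) * (C * E) * b₁.loc y' μ :=
          mul_le_mul_of_nonneg_right (mul_le_mul hinv hCe (by positivity) (by positivity)) hl0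
      _ = M := by rw [hM, div_eq_mul_inv]; ring
  have hsupPart : Wscl i p y * (Size.ofSup (toB6 (geo9K i) R H) (fun (q : XBK κ i) (y : IBondY i) => NearY i y (srcY i q))).sz y (T μ) ≤
      (((ℓ + 1 : ℕ) : ℝ)) ^ p * C * E * b₁.loc y' μ := by
    have h1 : (Size.ofSup (toB6 (geo9K i) R H) (fun (q : XBK κ i) (y : IBondY i) => NearY i y (srcY i q))).sz y (T μ) ≤ M :=
      ofSup_sz_le _ hM0 fun q hq => hpt q hq
    calc Wscl i p y * _ ≤ Wscl i p y * M := mul_le_mul_of_nonneg_left h1 hWy.le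
      _ = _ := by rw [hM, ← mul_assoc, mul_inv_cancel₀ hWy.ne', one_mul]
  -- THE PAIR PART, probe by probe
  have hpair : ∀ q q' : XBK κ i, NearY i y (srcY i q) → NearPairK i q q' →
      wEtaK i s q q' * |trDif b g q q' (T μ)| ≤ Cb * E * b₁.loc y' μ := by
    intro q q' hq hqq
    rw [wEtaK_mul_abs_trDif_eq i b hcf g s (T μ) hqq, ← LinearMap.comp_apply]
    -- the pair probe is anchored at `bI q.1` (`blkPK_inl`, definitional)
    have hv : |(probeK b g (wKA i s) (w₀K i s) ∘ₗ T) μ (Sum.inl ((q.1, q'.1), q.2))| ≤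
        ((geo9K i).len (bI q.1) ^ (s - 1))⁻¹ * (Cb * Real.exp (-(δ * (geo9K i).dist (bI q.1) y'))) * b₁.loc y' μ :=
      abs_apply_le_of_hasMaj_cNormR i hlen hpr hμ (Sum.inl ((q.1, q'.1), q.2))
    have hl1 : ((geo9K i).len (bI q.1) ^ (s - 1))⁻¹ ≤ 1 := by
      rw [← Real.rpow_neg (hlen _), neg_sub]
      exact Real.rpow_le_one (hlen _) (len_le_one i hcf _) (by linarith)
    have hCe : Cb * Real.exp (-(δ * (geo9K i).dist (bI q.1) y')) ≤ Cb * E := mul_le_mul_of_nonneg_left (hexp q hq) hCb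
    calc _ ≤ ((geo9K i).len (bI q.1) ^ (s - 1))⁻¹ * (Cb * Real.exp (-(δ * (geo9K i).dist (bI q.1) y'))) * b₁.loc y' μ := hv
      _ ≤ 1 * (Cb * E) * b₁.loc y' μ :=
          mul_le_mul_of_nonneg_right (mul_le_mul hl1 hCe (by positivity) zero_le_one) hl0
      _ = _ := by ring
  have hpairPart : (Size.ofPairsT (toB6 (geo9K i) R H) (fun (q : XBK κ i) (y : IBondY i) => NearY i y (srcY i q)) (NearPairK i) (wEtaK i s)
        (wEtaK_nonneg i s) (trDif b g)).sz y (T μ) ≤ Cb * E * b₁.loc y' μ :=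
    ofPairsT_sz_le _ _ _ _ _ (by positivity) fun q q' hq hqq => hpair q q' hq hqq
  calc _ ≤ (((ℓ + 1 : ℕ) : ℝ)) ^ p * C * E * b₁.loc y' μ + Cb * E * b₁.loc y' μ := add_le_add hsupPart hpairPart
    _ = _ := by rw [hE]; ring

/-! ## §5 ★★ An ∀ s family of probe members lands ONCE in the graded class -/

/-- ★★ **PIN RECIPE (R6)'S LANDING ADAPTER ON THE BOND CARRIER**: a producer proved as a 𝔠^{(−p)}-sup member (`C·e^{−δd}`) plus an ∀ s ∈ (0,1) family of probe
members (`C_b(s)·e^{−δd}`, the (3.43)-type words with `B₀(s) → ∞` allowed) is bounded INTO THE GRADED CLASS `bHZKG g p w` with majorant `(Lᵖ·C + C_b₀)·e^{δr}·e^{−δd}`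
as soon as the weights absorb the constants, `w s·C_b(s) ≤ C_b₀` (e.g. `w s := min 1 (C_b₀ ∕ C_b s)`). [cite: Balaban1985BackgroundPropagators, Thm 3.1 p.397 («B₀(β) → ∞ if β → 1») + (3.43) p.398 + Thm 3.13 p.426; Balaban1984PropagatorsII, (2.51)–(2.54) pp.232–233] -/
theorem hasMaj_into_bHZKG_of_probeFamily {p : ℝ} (h1p : 1 ≤ p) (w : ℝ → ℝ) (hw0 : ∀ s, 0 ≤ w s) (hw1 : ∀ s, w s ≤ 1)
    (hlev : ∀ f : FBondY i, lvl i.hN i.D i.hk (bI f) = (blkV1 i.hN i.D f).1.1) (hbI0 : ∀ f : FBondY i, bI f = bI ⟨f.src, 0⟩)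
    {r δ : ℝ} (hδ : 0 ≤ δ) (hN : ∀ (y : IBondY i) (z : SiteY i), NearY i y z → (geo9K i).dist y (sIK i bI z) ≤ r)
    (hcf : |i.cf| = (nKT (toKT i) : ℝ))
    {b₁ : BlockNorm (toB6 (geo9K i) R H) F₁} {T : F₁ →ₗ[ℝ] (XBK κ i → ℝ)} {C Cb₀ : ℝ} {Cb : ℝ → ℝ} (hC : 0 ≤ C) (hCb₀ : 0 ≤ Cb₀)
    (hCb : ∀ s, 0 < s → s < 1 → 0 ≤ Cb s) (hwCb : ∀ s, 0 < s → s < 1 → w s * Cb s ≤ Cb₀)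
    (hsup : HasMaj b₁ (cNormR R H (blkBK i bI) hlen (-p)) T (fun a a' => C * Real.exp (-(δ * (geo9K i).dist a a'))))
    (hpr : ∀ s, 0 < s → s < 1 → HasMaj b₁ (cNormR R H (blkPK bI) hlen (s - 1)) (probeK b g (wKA i s) (w₀K i s) ∘ₗ T)
      (fun a a' => Cb s * Real.exp (-(δ * (geo9K i).dist a a')))) :
    HasMaj b₁ (bHZKG (κ := κ) i b g (R := R) (H := H) h1p w hw0 hw1) T
      (fun y y' => ((((ℓ + 1 : ℕ) : ℝ)) ^ p * C + Cb₀) * Real.exp (δ * r) * Real.exp (-(δ * (geo9K i).dist y y'))) := by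
  have hL0 : (0 : ℝ) ≤ ((ℓ + 1 : ℕ) : ℝ) := Nat.cast_nonneg _
  have hLp : 0 ≤ (((ℓ + 1 : ℕ) : ℝ)) ^ p := Real.rpow_nonneg hL0 p
  refine hasMaj_into_bHZKG i b h1p w hw0 hw1 g
    (K := fun s y y' => ((((ℓ + 1 : ℕ) : ℝ)) ^ p * C + Cb s) * Real.exp (δ * r) * Real.exp (-(δ * (geo9K i).dist y y')))
    (fun _ _ => by positivity) (fun s hs0 hs1 a c => ?_) fun s hs0 hs1 =>
      hasMaj_into_bHZKT_of_probeMaj i b g hlen hs0.le hs1.le (hs1.le.trans h1p) hlev hbI0 hδ hN hcf hC (hCb s hs0 hs1) hsup (hpr s hs0 hs1)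
  -- `w s·(Lᵖ C + C_b s) ≤ Lᵖ C + C_b₀`
  have h1 : w s * ((((ℓ + 1 : ℕ) : ℝ)) ^ p * C) ≤ (((ℓ + 1 : ℕ) : ℝ)) ^ p * C := mul_le_of_le_one_left (mul_nonneg hLp hC) (hw1 s)
  have h2 := hwCb s hs0 hs1
  have hE0 : 0 ≤ Real.exp (δ * r) * Real.exp (-(δ * (geo9K i).dist a c)) := by positivity
  calc w s * (((((ℓ + 1 : ℕ) : ℝ)) ^ p * C + Cb s) * Real.exp (δ * r) * Real.exp (-(δ * (geo9K i).dist a c)))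
      = (w s * ((((ℓ + 1 : ℕ) : ℝ)) ^ p * C) + w s * Cb s) * (Real.exp (δ * r) * Real.exp (-(δ * (geo9K i).dist a c))) := by ring
    _ ≤ ((((ℓ + 1 : ℕ) : ℝ)) ^ p * C + Cb₀) * (Real.exp (δ * r) * Real.exp (-(δ * (geo9K i).dist a c))) :=
        mul_le_mul_of_nonneg_right (add_le_add h1 h2) hE0
    _ = _ := by ring

end Main

/-! ## §6 The radius discharged by LAYER B; `gXH_of_closure`'s binder shape -/

section Near

variable [Fintype (geo9K i).Site] (b : Module.Basis κ ℝ 𝔸) (g : FBondY i → FBondY i → 𝔸ˣ) {R : ℝ} {H : Prop}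
variable (hlen : ∀ y : (geo9K i).Site, 0 ≤ (geo9K i).len y) {bI : FBondY i → IBondY i}
variable {F₁ : Type} [AddCommGroup F₁] [Module ℝ F₁]

/-- ★★ §4 with the LAYER-B radius discharged (dag-n06-w6 `dist_sIK_le_of_nearY`, `r := rNear d ℓ + 1`): binders = the certificate's `hβ1 hlev hbI0` + print's units.
[cite: Balaban1985BackgroundPropagators, (3.40) p.397 + (3.42)–(3.43) pp.397–398; Balaban1984PropagatorsII, (2.51)–(2.54) pp.232–233] -/
theorem hasMaj_into_bHZKT_of_probeMaj_near {s p : ℝ} (hs0 : 0 ≤ s) (hs1 : s ≤ 1) (hsp : s ≤ p)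
    (hβ1 : ∀ f : FBondY i, (B6Geom246MultiLevelTorus.geomT i.D).dist (β i.hN i.D i.hk (bI f)) (blkV1 i.hN i.D f) ≤ 1)
    (hlev : ∀ f : FBondY i, lvl i.hN i.D i.hk (bI f) = (blkV1 i.hN i.D f).1.1) (hbI0 : ∀ f : FBondY i, bI f = bI ⟨f.src, 0⟩)
    {δ : ℝ} (hδ : 0 ≤ δ) (hcf : |i.cf| = (nKT (toKT i) : ℝ))
    {b₁ : BlockNorm (toB6 (geo9K i) R H) F₁} {T : F₁ →ₗ[ℝ] (XBK κ i → ℝ)} {C Cb : ℝ} (hC : 0 ≤ C) (hCb : 0 ≤ Cb)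
    (hsup : HasMaj b₁ (cNormR R H (blkBK i bI) hlen (-p)) T (fun a a' => C * Real.exp (-(δ * (geo9K i).dist a a'))))
    (hpr : HasMaj b₁ (cNormR R H (blkPK bI) hlen (s - 1)) (probeK b g (wKA i s) (w₀K i s) ∘ₗ T)
      (fun a a' => Cb * Real.exp (-(δ * (geo9K i).dist a a')))) :
    HasMaj b₁ (bHZKT (κ := κ) i b g (R := R) (H := H) hs0 hs1 hsp) T
      (fun y y' => ((((ℓ + 1 : ℕ) : ℝ)) ^ p * C + Cb) * Real.exp (δ * (rNear d ℓ + 1)) * Real.exp (-(δ * (geo9K i).dist y y'))) :=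
  hasMaj_into_bHZKT_of_probeMaj i b g hlen hs0 hs1 hsp hlev hbI0 hδ (fun _ _ h => dist_sIK_le_of_nearY i hβ1 h) hcf hC hCb hsup hpr

/-- ★★ §5 with the LAYER-B radius discharged. [cite: Balaban1985BackgroundPropagators, Thm 3.1 p.397 + (3.43) p.398; Balaban1984PropagatorsII, (2.51)–(2.54) pp.232–233] -/
theorem hasMaj_into_bHZKG_of_probeFamily_near {p : ℝ} (h1p : 1 ≤ p) (w : ℝ → ℝ) (hw0 : ∀ s, 0 ≤ w s) (hw1 : ∀ s, w s ≤ 1)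
    (hβ1 : ∀ f : FBondY i, (B6Geom246MultiLevelTorus.geomT i.D).dist (β i.hN i.D i.hk (bI f)) (blkV1 i.hN i.D f) ≤ 1)
    (hlev : ∀ f : FBondY i, lvl i.hN i.D i.hk (bI f) = (blkV1 i.hN i.D f).1.1) (hbI0 : ∀ f : FBondY i, bI f = bI ⟨f.src, 0⟩)
    {δ : ℝ} (hδ : 0 ≤ δ) (hcf : |i.cf| = (nKT (toKT i) : ℝ))
    {b₁ : BlockNorm (toB6 (geo9K i) R H) F₁} {T : F₁ →ₗ[ℝ] (XBK κ i → ℝ)} {C Cb₀ : ℝ} {Cb : ℝ → ℝ} (hC : 0 ≤ C) (hCb₀ : 0 ≤ Cb₀)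
    (hCb : ∀ s, 0 < s → s < 1 → 0 ≤ Cb s) (hwCb : ∀ s, 0 < s → s < 1 → w s * Cb s ≤ Cb₀)
    (hsup : HasMaj b₁ (cNormR R H (blkBK i bI) hlen (-p)) T (fun a a' => C * Real.exp (-(δ * (geo9K i).dist a a'))))
    (hpr : ∀ s, 0 < s → s < 1 → HasMaj b₁ (cNormR R H (blkPK bI) hlen (s - 1)) (probeK b g (wKA i s) (w₀K i s) ∘ₗ T)
      (fun a a' => Cb s * Real.exp (-(δ * (geo9K i).dist a a')))) :
    HasMaj b₁ (bHZKG (κ := κ) i b g (R := R) (H := H) h1p w hw0 hw1) T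
      (fun y y' => ((((ℓ + 1 : ℕ) : ℝ)) ^ p * C + Cb₀) * Real.exp (δ * (rNear d ℓ + 1)) * Real.exp (-(δ * (geo9K i).dist y y'))) :=
  hasMaj_into_bHZKG_of_probeFamily i b g hlen h1p w hw0 hw1 hlev hbI0 hδ (fun _ _ h => dist_sIK_le_of_nearY i hβ1 h) hcf hC hCb₀ hCb hwCb hsup hpr

/-- ★ **`gXH_of_closure`'S CLOSURE BINDER `hXcl` AT THE TRANSPORTED BOND PIN, HONEST FACTOR**: source `𝔠_Y⁽⁰⁾` (any sharp sup class), sup component into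
`cNorm … (blkBK bI) 1`, probe component into `cNormR … (blkPK bI) (β₀ − 1)` — `B9Thm313WholeCutLettersSupFrom344.gXH_of_closure`'s `hXcl` shape — conclude into
`bHZKT g β₀ 1` with constant `(L·C + C_b)·e^{δ(r_near+1)}` (the flat-class statement's `C + C_b` is the `U = 1`, `L = 1` idealisation; the factor is member- and
`U`-uniform). [cite: Balaban1985BackgroundPropagators, Thm 3.12 p.423 + (3.138) p.423 + (3.42)–(3.43) pp.397–398; Balaban1984PropagatorsII, (2.52)–(2.54) pp.232–233] -/
theorem hXcl_bHZKT {β₀ : ℝ} (hβ0 : 0 ≤ β₀) (hβ1' : β₀ ≤ 1)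
    (hβ1 : ∀ f : FBondY i, (B6Geom246MultiLevelTorus.geomT i.D).dist (β i.hN i.D i.hk (bI f)) (blkV1 i.hN i.D f) ≤ 1)
    (hlev : ∀ f : FBondY i, lvl i.hN i.D i.hk (bI f) = (blkV1 i.hN i.D f).1.1) (hbI0 : ∀ f : FBondY i, bI f = bI ⟨f.src, 0⟩)
    (hcf : |i.cf| = (nKT (toKT i) : ℝ)) {Y : Type} [Fintype Y] (blkY : Y → IBondY i)
    (T : (Y → ℝ) →ₗ[ℝ] (XBK κ i → ℝ)) {C Cb r : ℝ} (hC : 0 ≤ C) (hCb : 0 ≤ Cb) (hr : 0 ≤ r)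
    (hsup : HasMaj (cNorm R H blkY hlen 0) (cNorm R H (blkBK i bI) hlen 1) T (fun a a' => C * Real.exp (-(r * (geo9K i).dist a a'))))
    (hpr : HasMaj (cNormR R H blkY hlen 0) (cNormR R H (blkPK bI) hlen (β₀ - 1)) (probeK b g (wKA i β₀) (w₀K i β₀) ∘ₗ T)
      (fun a a' => Cb * Real.exp (-(r * (geo9K i).dist a a')))) :
    HasMaj (cNorm R H blkY hlen 0) (bHZKT (κ := κ) i b g (R := R) (H := H) hβ0 hβ1' hβ1') T
      (fun a a' => ((((ℓ + 1 : ℕ) : ℝ)) * C + Cb) * Real.exp (r * (rNear d ℓ + 1)) * Real.exp (-(r * (geo9K i).dist a a'))) := by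
  -- `cNorm … 1` is `cNormR … (−1)` and `cNormR … 0` is `cNorm … 0` on the nose of the local sizes
  have hsup' : HasMaj (cNorm R H blkY hlen 0) (cNormR R H (blkBK i bI) hlen (-(1 : ℝ))) T
      (fun a a' => C * Real.exp (-(r * (geo9K i).dist a a'))) := by
    intro y' μ hμ y
    have h := hsup y' μ hμ y
    rw [cNormR_loc, Real.rpow_neg (hlen y), Real.rpow_one]
    rw [show (cNorm R H (blkBK i bI) hlen 1).loc y (T μ) = wt (geo9K i) 1 y * (BlockNorm.ofBlocks (toB6 (geo9K i) R H) (blkBK i bI)).loc y (T μ)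
      from rfl, wt, pow_one] at h
    exact h
  have hpr' : HasMaj (cNorm R H blkY hlen 0) (cNormR R H (blkPK bI) hlen (β₀ - 1)) (probeK b g (wKA i β₀) (w₀K i β₀) ∘ₗ T)
      (fun a a' => Cb * Real.exp (-(r * (geo9K i).dist a a'))) := by
    intro y' μ hμ y
    have h := hpr y' μ hμ y
    have e0 : (cNormR R H blkY hlen 0).loc y' μ = (cNorm R H blkY hlen 0).loc y' μ := by
      rw [cNormR_loc, Real.rpow_zero, one_mul, show (cNorm R H blkY hlen 0).loc y' μ =
        wt (geo9K i) 0 y' * (BlockNorm.ofBlocks (toB6 (geo9K i) R H) blkY).loc y' μ from rfl, wt, pow_zero, inv_one, one_mul]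
    rw [e0] at h
    exact h
  have h := hasMaj_into_bHZKT_of_probeMaj_near i b g hlen hβ0 hβ1' hβ1' hβ1 hlev hbI0 hr hcf hC hCb hsup' hpr'
  simp only [Real.rpow_one] at h
  exact h

end Near

end Literature.MathematicalPhysics.QuantumFieldTheory.Balaban1983to89.B9SmoothHolderClassTClosure
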